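/-
Copyright: public-audit package `pub-balaban` (b2b-balaban), seat pv09-g4. Released under Apache 2.0 like Mathlib.
-/
import Literature.MathematicalPhysics.QuantumFieldTheory.Balaban1983to89.B6FaceLowerBound

/-!
# B6, Lemma 2.4 assembled on the concrete carrier: `B6.Step2127` and `B6.Lemma24K` with the layer constant κ₀

Source under audit: T. Bałaban, *Propagators and renormalization transformations for lattice gauge theories.
II*, Commun. Math. Phys. **96** (1984) 223–250 [B6], Lemma 2.4 and its proof, pp. 244–245.

## Text (verbatim, p. 245 after (2.127) and p. 246 l. 1–2; renders `…-p023-x2.png`, `…-p024-x2.png` READ AS IMAGES)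

*"The inequalities (2.123) and (2.127) imply many other inequalities. One of them is formulated in"* — followed at
once by the statement of Lemma 2.4 with (2.128) (quoted verbatim in `B6Lemma24Carrier`), which ends p. 245;
p. 246 opens *"Another consequence is a bound from below for the form (2.120), or for the form (2.122)."*

PRINT GIVES NO SUMMATION TEXT.  The passage from the per-bond inequality (2.127) and (2.123) to (2.128) is not
written anywhere in [B6] (package census G-B6-08: "the combination is not written in print").  What this file
kernel-checks is the CELL's reconstruction of that passage (`HOME/b2b-balaban-r1` Lemma24-repair.md §3 Step 5
(a)(b)(c); `B6.lemma24_assembly_core` with the weights 1/(4d²), 1) in the N_cr-form, for the concrete carrier.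
DOCFIX v1.1: v1 of this file, p181038, headed this block «Text (verbatim, p. 245, after (2.127))» over a paragraph
(«Let us sum both sides of these inequalities over c ∈ Λ′. We use (2.123) and the fact that each block B(y) can be
block B(c₋) for d bonds c … hence finally we get (2.128).») that is NOT in the paper — withdrawn (x-read G-pv10-12
by pv10-g5); the decl tags that pointed at it are re-tagged [folklore] below; no statement or proof changed.

## What this file proves

The summation step, kernel-checked for the concrete objects of `B6Lemma24Carrier` (region Λ = ⋃_{y∈Λ′} B(y),
Λ′ ⊂ LZ^d finite, d ≥ 2, L ≥ 1, |(Q₁B)(c)|² = the printed expression (2.125), `q1Of`):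

* `step2127` : `B6.Step2127 d L κ₀ (carrier L Λ′ (q1Of L Λ′)) (split …)` — the summed (2.127) with the factor ⅓
  replaced by κ₀/3, κ₀ = `B6LayerPoincare.kappa0 d L` = 1/(4 + 6d(L−1)L^{d−2}) (the printed factor is refuted for
  L ≥ 10, `B6.ineq2127_fails_L10`); obtained by summing the per-face kernel theorem `B6FaceLowerBound.face2127`
  over the coarse bonds c meeting Λ′ (`coarseBonds`) and three pieces of bookkeeping:
  (a) `faces_le_pCr` — the plaquette families p ⊂ B(c) of (2.124) are plaquettes near Λ, not inside any block,
      and distinct for distinct (c, b): Σ_c Σ_{p⊂B(c)} |∂₁B|² ≤ P_cr;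
  (b) `crossing_cover` — every bond of Λ not inside a block of Λ is the crossing bond ⟨x, x + e_μ⟩, x ∈ Δ′(c), of a
      coarse bond c meeting Λ′: N_cr ≤ Σ_c Σ_{x∈Δ′(c)} B_μ(x)²;
  (c) `sum_blockSq_le` / `sum_blockSq_plus_le` — each block B(y) is the block B(c₋) of at most d coarse bonds c
      (one per direction), similarly B(c₊); the blocks outside Λ contribute 0 because *"B = 0 outside Λ"*
      (Lemma 2.4): Σ_c Σ_{b⊂B(c∓)} B(b)² ≤ d·N_in each.
* `lemma24K` : `B6.Lemma24K d L κ₀` for every family of such carriers — Lemma 2.4 with the constant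
  (κ₀/(12d²)) L^{−d−1} in place of the printed (1/(12d²)) L^{−d−1}, by `B6Lemma24Carrier.lemma24K_of_step2127`
  (whose (2.123) slot is the kernel theorem `B6TreeGaugePoincare.ineq2123`).

With this file the chain (2.123) → (2.124) → (2.125) → (p.245 sentence, repaired) → (2.126) → (2.127)_κ₀ → (2.128)_κ₀
is kernel-checked end to end on the concrete carrier; the only deviation from print is the constant κ₀ < 1
(package census G-B6-09R/G-B6-10: the printed sentence and (2.127) are false for L ≥ 10; the sharp repaired
constant κ_L = min{1, 4L sin²(π/2L)} of `B6.Lemma24Repaired` is NOT reached here — κ₀ is the crude layer constant).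

## HONEST SCOPE

Λ′ is any finite subset of LZ^d and the carrier's Q₁-term is the printed (2.125) expression summed over the coarse
bonds meeting Λ′ (`q1Of`); that this is the operator Q₁ of B5 (1.8) restricted as in (2.121), and the use of Lemma
2.4 inside Proposition 2.5, are not addressed here (see `B6Lemma24Carrier`, HONEST SCOPE).
-/

open Finset

namespace Literature.MathematicalPhysics.QuantumFieldTheory.Balaban1983to89.B6Lemma24Assembly

open B6Elimination (block mem_block)
open B6BondElimination (unitVec unitVec_apply add_unitVec_apply add_smul_unitVec_apply sub_smul_unitVec_apply)
open B6TreeGaugePoincare (Cfg curl innerBonds innerPlaq mem_innerBonds mem_innerBonds_iff mem_innerPlaq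
  mem_innerPlaq_iff)
open B6FaceInterpolation (lastLayer firstLayer bondsIn mem_lastLayer mem_firstLayer mem_bondsIn
  dir_ne_of_mem_bondsIn_lastLayer face_plaquette_corners)
open B6LayerPoincare (kappa0 kappa0_pos kappa0_le_one)
open B6Lemma24Carrier (lam mem_lam lamBonds mem_lamBonds lamPlaqBase lamPlaq mem_lamPlaq mem_lamPlaqBase_of_corner
  add_unitVec_corner eq_of_mem_block nIn pIn normSq d1Sq pairwiseDisjoint_innerBonds pairwiseDisjoint_innerPlaq
  carrier split coarseBonds q1Term q1Of q1Of_nonneg lemma24K_of_step2127)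
open B6FaceLowerBound (face2127)
open B6 (Step2127 Lemma24K)

noncomputable section

variable {d : ℕ} {L : ℕ}

/-! ## §1  Coarse bonds meeting Λ′ -/

/-- c = ⟨y, y + Le_μ⟩ meets Λ′ iff c₋ = y ∈ Λ′ or c₊ = y + Le_μ ∈ Λ′. [folklore] -/
theorem mem_coarseBonds {Λ' : Finset (Fin d → ℤ)} {c : (Fin d → ℤ) × Fin d} :
    c ∈ coarseBonds L Λ' ↔ c.1 ∈ Λ' ∨ c.1 + (L : ℤ) • unitVec c.2 ∈ Λ' := by
  rw [coarseBonds, mem_union, mem_image]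
  simp only [mem_product, mem_univ, and_true]
  constructor
  · rintro (h | ⟨c', hc', rfl⟩)
    · exact Or.inl h
    · right
      simp only [sub_add_cancel]
      exact hc'
  · rintro (h | h)
    · exact Or.inl h
    · exact Or.inr ⟨(c.1 + (L : ℤ) • unitVec c.2, c.2), h, Prod.ext (add_sub_cancel_right _ _) rfl⟩

/-- Both end points of a coarse bond meeting Λ′ ⊂ LZ^d lie in LZ^d; in particular L ∣ (c₋)_i. [folklore] -/
theorem dvd_of_mem_coarseBonds {Λ' : Finset (Fin d → ℤ)} (hΛ : ∀ y ∈ Λ', ∀ i, (L : ℤ) ∣ y i)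
    {c : (Fin d → ℤ) × Fin d} (hc : c ∈ coarseBonds L Λ') (i : Fin d) : (L : ℤ) ∣ c.1 i := by
  rcases mem_coarseBonds.1 hc with h | h
  · exact hΛ _ h i
  · have h1 := hΛ _ h i
    rw [add_smul_unitVec_apply] at h1
    have h2 : (L : ℤ) ∣ (if i = c.2 then (L : ℤ) else 0) := by split_ifs <;> simp
    simpa using (dvd_sub h1 h2)

/-! ## §2  Each block B(y) is B(c₋) for at most d coarse bonds c, similarly B(c₊); "B = 0 outside Λ" -/

/-- A bond inside a block B(y) of the L-lattice with y ∉ Λ′ does not meet Λ (the blocks partition ℤ^d).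
[folklore] -/
theorem innerBonds_not_mem_lamBonds (hL : 0 < L) {Λ' : Finset (Fin d → ℤ)}
    (hΛ : ∀ y ∈ Λ', ∀ i, (L : ℤ) ∣ y i) {y : Fin d → ℤ} (hy : y ∉ Λ') (hyL : ∀ i, (L : ℤ) ∣ y i)
    {b : (Fin d → ℤ) × Fin d} (hb : b ∈ innerBonds L y) : b ∉ lamBonds L Λ' := fun h => by
  obtain ⟨hb1, hb2⟩ := mem_innerBonds_iff.1 hb
  rcases mem_lamBonds.1 h with h | h
  · obtain ⟨y', hy', hxy'⟩ := mem_lam.1 h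
    exact hy (by rw [eq_of_mem_block hL hyL (hΛ y' hy') hb1 hxy']; exact hy')
  · obtain ⟨y', hy', hxy'⟩ := mem_lam.1 h
    exact hy (by rw [eq_of_mem_block hL hyL (hΛ y' hy') hb2 hxy']; exact hy')

/-- For any finite set S of pairs (y, μ) with y ∈ LZ^d and B = 0 outside Λ:
Σ_{(y,μ)∈S} Σ_{b⊂B(y)} B(b)² ≤ d · N_in(B) — each block of Λ occurs for at most d directions μ, the other blocks
contribute 0.  (Bookkeeping of the cell's reconstruction; the assembly is not written in print, census G-B6-08.) [folklore] -/
theorem sum_blockSq_le (hL : 0 < L) {Λ' : Finset (Fin d → ℤ)} (hΛ : ∀ y ∈ Λ', ∀ i, (L : ℤ) ∣ y i)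
    {B : Cfg d} (hB : ∀ b, b ∉ lamBonds L Λ' → B b = 0) (S : Finset ((Fin d → ℤ) × Fin d))
    (hS : ∀ c ∈ S, ∀ i, (L : ℤ) ∣ c.1 i) :
    ∑ c ∈ S, ∑ b ∈ innerBonds L c.1, B b ^ 2 ≤ (d : ℝ) * nIn L Λ' B := by
  classical
  rw [← sum_filter_add_sum_filter_not S (fun c => c.1 ∈ Λ')]
  have h0 : ∑ c ∈ S.filter (fun c => ¬ c.1 ∈ Λ'), ∑ b ∈ innerBonds L c.1, B b ^ 2 = 0 := by
    refine sum_eq_zero fun c hc => sum_eq_zero fun b hb => ?_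
    obtain ⟨hcS, hc⟩ := mem_filter.1 hc
    rw [hB b (innerBonds_not_mem_lamBonds hL hΛ hc (hS c hcS) hb)]
    ring
  rw [h0, add_zero]
  calc ∑ c ∈ S.filter (fun c => c.1 ∈ Λ'), ∑ b ∈ innerBonds L c.1, B b ^ 2
      ≤ ∑ c ∈ Λ' ×ˢ (univ : Finset (Fin d)), ∑ b ∈ innerBonds L c.1, B b ^ 2 :=
        sum_le_sum_of_subset_of_nonneg (fun c hc => mem_product.2 ⟨(mem_filter.1 hc).2, mem_univ _⟩)
          fun _ _ _ => sum_nonneg fun _ _ => sq_nonneg _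
    _ = (d : ℝ) * nIn L Λ' B := by
        rw [sum_product, nIn, mul_sum]
        refine sum_congr rfl fun y _ => ?_
        dsimp only
        rw [sum_const, card_univ, Fintype.card_fin, nsmul_eq_mul]

/-- The c₋-count: Σ_{c meeting Λ′} Σ_{b⊂B(c₋)} B(b)² ≤ d · N_in(B) (B = 0 outside Λ).  (Cell's reconstruction,
census G-B6-08; not in print.) [folklore] -/
theorem sum_blockSq_minus_le (hL : 0 < L) {Λ' : Finset (Fin d → ℤ)} (hΛ : ∀ y ∈ Λ', ∀ i, (L : ℤ) ∣ y i)
    {B : Cfg d} (hB : ∀ b, b ∉ lamBonds L Λ' → B b = 0) :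
    ∑ c ∈ coarseBonds L Λ', ∑ b ∈ innerBonds L c.1, B b ^ 2 ≤ (d : ℝ) * nIn L Λ' B :=
  sum_blockSq_le hL hΛ hB _ fun _ hc => dvd_of_mem_coarseBonds hΛ hc

/-- The c₊-count: Σ_{c meeting Λ′} Σ_{b⊂B(c₊)} B(b)² ≤ d · N_in(B) (B = 0 outside Λ).  (Cell's reconstruction,
census G-B6-08; not in print.) [folklore] -/
theorem sum_blockSq_plus_le (hL : 0 < L) {Λ' : Finset (Fin d → ℤ)} (hΛ : ∀ y ∈ Λ', ∀ i, (L : ℤ) ∣ y i)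
    {B : Cfg d} (hB : ∀ b, b ∉ lamBonds L Λ' → B b = 0) :
    ∑ c ∈ coarseBonds L Λ', ∑ b ∈ innerBonds L (c.1 + (L : ℤ) • unitVec c.2), B b ^ 2 ≤
      (d : ℝ) * nIn L Λ' B := by
  classical
  have hinj : Set.InjOn (fun c : (Fin d → ℤ) × Fin d => (c.1 + (L : ℤ) • unitVec c.2, c.2))
      ↑(coarseBonds L Λ') := fun c _ c' _ h => by
    simp only [Prod.mk.injEq] at h
    obtain ⟨h1, h2⟩ := h
    rw [h2] at h1
    exact Prod.ext (add_right_cancel h1) h2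
  rw [← sum_image (f := fun c : (Fin d → ℤ) × Fin d => ∑ b ∈ innerBonds L c.1, B b ^ 2) hinj]
  refine sum_blockSq_le hL hΛ hB _ fun c hc i => ?_
  obtain ⟨c', hc', rfl⟩ := mem_image.1 hc
  dsimp only
  rw [add_smul_unitVec_apply]
  exact dvd_add (dvd_of_mem_coarseBonds hΛ hc' i) (by split_ifs <;> simp)

/-! ## §3  N_cr is carried by the crossing bonds of the coarse bonds meeting Λ′ -/

/-- Every bond of Λ that is not inside a block of Λ is a crossing bond ⟨x, x + e_μ⟩, x ∈ Δ′(c), of a coarse bond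
c meeting Λ′; hence N_cr(B) = ‖B‖² − N_in(B) ≤ Σ_c Σ_{x∈Δ′(c)} B_μ(x)² (in fact "=": the families are disjoint).
(Cell's reconstruction, census G-B6-08; not in print.) [folklore] -/
theorem crossing_cover (hL : 0 < L) {Λ' : Finset (Fin d → ℤ)} (hΛ : ∀ y ∈ Λ', ∀ i, (L : ℤ) ∣ y i)
    (B : Cfg d) :
    normSq L Λ' B - nIn L Λ' B ≤ ∑ c ∈ coarseBonds L Λ', ∑ x ∈ lastLayer L c.1 c.2, B (x, c.2) ^ 2 := by
  classical
  have hU : Λ'.biUnion (innerBonds L) ⊆ lamBonds L Λ' := fun b hb => by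
    obtain ⟨y, hy, hby⟩ := mem_biUnion.1 hb
    exact mem_lamBonds.2 (Or.inl (mem_lam.2 ⟨y, hy, (mem_innerBonds.1 hby).1⟩))
  have hn : nIn L Λ' B = ∑ b ∈ Λ'.biUnion (innerBonds L), B b ^ 2 := by
    rw [nIn, sum_biUnion (pairwiseDisjoint_innerBonds hL hΛ)]
  have hsd : normSq L Λ' B - nIn L Λ' B = ∑ b ∈ lamBonds L Λ' \ Λ'.biUnion (innerBonds L), B b ^ 2 := by
    rw [hn, normSq, ← sum_sdiff hU]
    ring
  have hdisj : (↑(coarseBonds L Λ') : Set ((Fin d → ℤ) × Fin d)).PairwiseDisjoint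
      (fun c => (lastLayer L c.1 c.2).image fun x => (x, c.2)) := by
    intro c hc c' hc' hne
    rw [Function.onFun, disjoint_left]
    intro b hb hb'
    obtain ⟨x, hx, rfl⟩ := mem_image.1 hb
    obtain ⟨x', hx', hxx⟩ := mem_image.1 hb'
    simp only [Prod.mk.injEq] at hxx
    obtain ⟨hx1, h2⟩ := hxx
    rw [hx1] at hx'
    exact hne (Prod.ext (eq_of_mem_block hL (dvd_of_mem_coarseBonds hΛ (mem_coe.1 hc))
      (dvd_of_mem_coarseBonds hΛ (mem_coe.1 hc')) (mem_lastLayer.1 hx).1 (mem_lastLayer.1 hx').1) h2.symm)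
  have hcs : ∑ c ∈ coarseBonds L Λ', ∑ x ∈ lastLayer L c.1 c.2, B (x, c.2) ^ 2 =
      ∑ b ∈ (coarseBonds L Λ').biUnion (fun c => (lastLayer L c.1 c.2).image fun x => (x, c.2)), B b ^ 2 := by
    rw [sum_biUnion hdisj]
    refine sum_congr rfl fun c _ => ?_
    rw [sum_image fun x _ x' _ h => by simpa using congr_arg Prod.fst h]
  rw [hsd, hcs]
  refine sum_le_sum_of_subset_of_nonneg (fun b hb => ?_) fun _ _ _ => sq_nonneg _
  obtain ⟨hbl, hbU⟩ := mem_sdiff.1 hb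
  have hnot : ∀ y ∈ Λ', b ∉ innerBonds L y := fun y hy h => hbU (mem_biUnion.2 ⟨y, hy, h⟩)
  rcases mem_lamBonds.1 hbl with h | h
  · -- x ∈ B(y), y ∈ Λ′, x + e_ν ∉ B(y): x ∈ Δ′(y, ν), c = (y, ν), c₋ ∈ Λ′
    obtain ⟨y, hy, hxy⟩ := mem_lam.1 h
    have hb1 := mem_block.1 hxy b.2
    have hnn := hnot y hy
    rw [mem_innerBonds] at hnn
    have hco : b.1 b.2 = y b.2 + L - 1 := by
      by_contra hne
      exact hnn ⟨hxy, by omega⟩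
    exact mem_biUnion.2 ⟨(y, b.2), mem_coarseBonds.2 (Or.inl hy),
      mem_image.2 ⟨b.1, mem_lastLayer.2 ⟨hxy, hco⟩, rfl⟩⟩
  · -- x ∉ Λ-block of x + e_ν ∈ B(y′), y′ ∈ Λ′: x ∈ Δ′(y′ − Le_ν, ν), c₊ = y′ ∈ Λ′
    obtain ⟨y', hy', hxy'⟩ := mem_lam.1 h
    have hb2 := mem_block.1 hxy'
    have hnn := hnot y' hy'
    rw [mem_innerBonds_iff] at hnn
    have hx_not : b.1 ∉ block L y' := fun hx => hnn ⟨hx, hxy'⟩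
    have hco : b.1 b.2 + 1 = y' b.2 := by
      have hν := hb2 b.2
      rw [add_unitVec_apply, if_pos rfl] at hν
      by_contra hne
      apply hx_not
      refine mem_block.2 fun i => ?_
      have hi := hb2 i
      rw [add_unitVec_apply] at hi
      by_cases hib : i = b.2
      · rw [hib]
        omega
      · rw [if_neg hib, add_zero] at hi
        exact hi
    have hyy : y' - (L : ℤ) • unitVec b.2 + (L : ℤ) • unitVec b.2 = y' := sub_add_cancel _ _
    refine mem_biUnion.2 ⟨(y' - (L : ℤ) • unitVec b.2, b.2), mem_coarseBonds.2 (Or.inr ?_),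
      mem_image.2 ⟨b.1, mem_lastLayer.2 ⟨mem_block.2 fun i => ?_, ?_⟩, rfl⟩⟩
    · dsimp only
      rw [hyy]
      exact hy'
    · have hi := hb2 i
      rw [add_unitVec_apply] at hi
      dsimp only
      rw [sub_smul_unitVec_apply]
      by_cases hib : i = b.2
      · rw [if_pos hib, hib]
        rw [hib, if_pos rfl] at hi
        omega
      · rw [if_neg hib, add_zero] at hi
        rw [if_neg hib]
        omega
    · dsimp only
      rw [sub_smul_unitVec_apply, if_pos rfl]
      omega

/-! ## §4  The plaquette families p ⊂ B(c) are among P_cr, once each -/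

/-- The plaquette p(b) ⊂ B(c) of the bond b = ⟨x, x + e_ν⟩ ⊂ Δ′(c), c = ⟨y, y + Le_μ⟩, recorded as in `lamPlaq`
(lowest corner x, directions ordered). [folklore] -/
def plaq (c b : (Fin d → ℤ) × Fin d) : (Fin d → ℤ) × Fin d × Fin d :=
  if b.2 < c.2 then (b.1, b.2, c.2) else (b.1, c.2, b.2)

/-- (∂₁B) is antisymmetric in the two directions of a plaquette. [folklore] -/
theorem curl_swap (B : Cfg d) (z : Fin d → ℤ) (j μ : Fin d) : curl B z μ j = -curl B z j μ := by
  simp only [curl]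
  ring

/-- |(∂₁B)(p(b))|² in the `lamPlaq` record equals the face value `curl B x ν μ`². [folklore] -/
theorem curl_plaq_sq (B : Cfg d) (c b : (Fin d → ℤ) × Fin d) :
    curl B (plaq c b).1 (plaq c b).2.1 (plaq c b).2.2 ^ 2 = curl B b.1 b.2 c.2 ^ 2 := by
  unfold plaq
  split_ifs with h
  · rfl
  · dsimp only
    rw [curl_swap, neg_sq]

/-- What the record p(b) remembers: the corner, and the unordered pair of directions. [folklore] -/
theorem plaq_eq {c c' b b' : (Fin d → ℤ) × Fin d} (h : plaq c b = plaq c' b') :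
    b.1 = b'.1 ∧ ((b.2 = b'.2 ∧ c.2 = c'.2) ∨ (b.2 = c'.2 ∧ c.2 = b'.2)) := by
  unfold plaq at h
  split_ifs at h <;> simp only [Prod.mk.injEq] at h <;> exact ⟨h.1, by tauto⟩

/-- Distinct bonds b ⊂ Δ′(c) give distinct plaquettes p(b). [folklore] -/
theorem plaq_injOn (c : (Fin d → ℤ) × Fin d) :
    Set.InjOn (plaq c) ↑(bondsIn (lastLayer L c.1 c.2)) := fun b hb b' _ h => by
  have hne := dir_ne_of_mem_bondsIn_lastLayer (mem_coe.1 hb)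
  obtain ⟨h1, h2 | h2⟩ := plaq_eq h
  · exact Prod.ext h1 h2.1
  · exact absurd h2.1 hne

/-- p(b) ⊂ B(c) is a plaquette near Λ (c meets Λ′: its corner x ∈ Δ′ ⊂ B(c₋) or its corner x + e_μ ∈ Δ″ ⊂ B(c₊)
lies in Λ). [folklore] -/
theorem plaq_mem_lamPlaq (hL : 1 ≤ L) {Λ' : Finset (Fin d → ℤ)} {c : (Fin d → ℤ) × Fin d}
    (hc : c ∈ coarseBonds L Λ') {b : (Fin d → ℤ) × Fin d} (hb : b ∈ bondsIn (lastLayer L c.1 c.2)) :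
    plaq c b ∈ lamPlaq L Λ' := by
  have hne := dir_ne_of_mem_bondsIn_lastLayer hb
  obtain ⟨hx, -, hxμ, -⟩ := face_plaquette_corners hL hb
  have hbase : b.1 ∈ lamPlaqBase L Λ' := by
    rcases mem_coarseBonds.1 hc with h | h
    · exact mem_lamPlaqBase_of_corner (fun i => Or.inl rfl) (mem_lam.2 ⟨c.1, h, (mem_lastLayer.1 hx).1⟩)
    · exact mem_lamPlaqBase_of_corner (add_unitVec_corner b.1 c.2) (mem_lam.2 ⟨_, h, (mem_firstLayer.1 hxμ).1⟩)
  unfold plaq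
  split_ifs with h
  · exact mem_lamPlaq.2 ⟨hbase, h⟩
  · exact mem_lamPlaq.2 ⟨hbase, lt_of_le_of_ne (not_lt.1 h) (Ne.symm hne)⟩

/-- p(b) ⊂ B(c) is not inside any block of Λ: it contains the crossing bond ⟨x, x + e_μ⟩ with x in the last
layer of B(c₋). [folklore] -/
theorem plaq_not_mem_innerPlaq (hL : 0 < L) {Λ' : Finset (Fin d → ℤ)} (hΛ : ∀ y ∈ Λ', ∀ i, (L : ℤ) ∣ y i)
    {c : (Fin d → ℤ) × Fin d} (hc : c ∈ coarseBonds L Λ') {b : (Fin d → ℤ) × Fin d}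
    (hb : b ∈ bondsIn (lastLayer L c.1 c.2)) {y' : Fin d → ℤ} (hy' : y' ∈ Λ') :
    plaq c b ∉ innerPlaq L y' := fun h => by
  obtain ⟨hxb, hxμ⟩ := mem_lastLayer.1 (mem_bondsIn.1 hb).1
  have key : b.1 ∈ block L y' ∧ b.1 + unitVec c.2 ∈ block L y' := by
    unfold plaq at h
    split_ifs at h
    · obtain ⟨-, hz, -, hzμ, -⟩ := mem_innerPlaq_iff.1 h
      exact ⟨hz, hzμ⟩
    · obtain ⟨-, hz, hzj, -, -⟩ := mem_innerPlaq_iff.1 h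
      exact ⟨hz, hzj⟩
  have e := eq_of_mem_block hL (dvd_of_mem_coarseBonds hΛ hc) (hΛ y' hy') hxb key.1
  have h2 := (mem_block.1 key.2 c.2).2
  rw [add_unitVec_apply, if_pos rfl, ← e] at h2
  omega

/-- The plaquette families of distinct coarse bonds meeting Λ′ are disjoint. [folklore] -/
theorem faces_pairwiseDisjoint (hL : 0 < L) {Λ' : Finset (Fin d → ℤ)} (hΛ : ∀ y ∈ Λ', ∀ i, (L : ℤ) ∣ y i) :
    (↑(coarseBonds L Λ') : Set ((Fin d → ℤ) × Fin d)).PairwiseDisjoint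
      (fun c => (bondsIn (lastLayer L c.1 c.2)).image (plaq c)) := by
  intro c hc c' hc' hne
  rw [Function.onFun, disjoint_left]
  intro p hp hp'
  obtain ⟨b, hb, rfl⟩ := mem_image.1 hp
  obtain ⟨b', hb', h⟩ := mem_image.1 hp'
  have hcd := dvd_of_mem_coarseBonds hΛ (mem_coe.1 hc)
  have hcd' := dvd_of_mem_coarseBonds hΛ (mem_coe.1 hc')
  obtain ⟨hxb, hxμ⟩ := mem_lastLayer.1 (mem_bondsIn.1 hb).1
  have hxb' := (mem_lastLayer.1 (mem_bondsIn.1 hb').1).1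
  have hb'2 := (mem_lastLayer.1 (mem_bondsIn.1 hb').2).1
  obtain ⟨hx, hdir⟩ := plaq_eq h.symm
  rw [← hx] at hxb'
  have e := eq_of_mem_block hL hcd hcd' hxb hxb'
  rcases hdir with ⟨-, hμ⟩ | ⟨hμ1, hμ2⟩
  · exact hne (Prod.ext e hμ)
  · have h3 := (mem_block.1 hb'2 c.2).2
    rw [← hx, ← hμ2, add_unitVec_apply, if_pos rfl, ← e] at h3
    omega

/-- Σ_c Σ_{b⊂Δ′(c)} |(∂₁B)(p(b))|² as a sum over the (disjoint) union of the plaquette families. [folklore] -/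
theorem faces_sum_eq (hL : 0 < L) {Λ' : Finset (Fin d → ℤ)} (hΛ : ∀ y ∈ Λ', ∀ i, (L : ℤ) ∣ y i)
    (B : Cfg d) :
    ∑ c ∈ coarseBonds L Λ', ∑ b ∈ bondsIn (lastLayer L c.1 c.2), curl B b.1 b.2 c.2 ^ 2 =
      ∑ p ∈ (coarseBonds L Λ').biUnion (fun c => (bondsIn (lastLayer L c.1 c.2)).image (plaq c)),
        curl B p.1 p.2.1 p.2.2 ^ 2 := by
  classical
  rw [sum_biUnion (faces_pairwiseDisjoint hL hΛ)]
  refine sum_congr rfl fun c _ => ?_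
  rw [sum_image (plaq_injOn c)]
  exact sum_congr rfl fun b _ => (curl_plaq_sq B c b).symm

/-- **(a)** Σ_{c meeting Λ′} Σ_{p⊂B(c)} |(∂₁B)(p)|² ≤ P_cr(B) = Σ_{p near Λ}|(∂₁B)(p)|² − P_in(B).
[cite: Balaban1984PropagatorsII, (2.124)+(2.128) p.245] -/
theorem faces_le_pCr (hL : 1 ≤ L) {Λ' : Finset (Fin d → ℤ)} (hΛ : ∀ y ∈ Λ', ∀ i, (L : ℤ) ∣ y i)
    (B : Cfg d) :
    ∑ c ∈ coarseBonds L Λ', ∑ b ∈ bondsIn (lastLayer L c.1 c.2), curl B b.1 b.2 c.2 ^ 2 ≤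
      d1Sq L Λ' B - pIn L Λ' B := by
  classical
  have hL0 : 0 < L := Nat.lt_of_lt_of_le Nat.zero_lt_one hL
  have hV : Λ'.biUnion (innerPlaq L) ⊆ lamPlaq L Λ' := fun p hp => by
    obtain ⟨y, hy, hpy⟩ := mem_biUnion.1 hp
    have h := mem_innerPlaq.1 hpy
    exact mem_lamPlaq.2 ⟨mem_lamPlaqBase_of_corner (fun i => Or.inl rfl) (mem_lam.2 ⟨y, hy, h.1⟩), h.2.1⟩
  have hp : pIn L Λ' B = ∑ p ∈ Λ'.biUnion (innerPlaq L), curl B p.1 p.2.1 p.2.2 ^ 2 := by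
    rw [pIn, sum_biUnion (pairwiseDisjoint_innerPlaq hL0 hΛ)]
  have hsd : d1Sq L Λ' B - pIn L Λ' B =
      ∑ p ∈ lamPlaq L Λ' \ Λ'.biUnion (innerPlaq L), curl B p.1 p.2.1 p.2.2 ^ 2 := by
    rw [hp, d1Sq, ← sum_sdiff hV]
    ring
  rw [hsd, faces_sum_eq hL0 hΛ B]
  refine sum_le_sum_of_subset_of_nonneg (fun p hp' => ?_) fun _ _ _ => sq_nonneg _
  obtain ⟨c, hc, hpc⟩ := mem_biUnion.1 hp'
  obtain ⟨b, hb, rfl⟩ := mem_image.1 hpc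
  exact mem_sdiff.2 ⟨plaq_mem_lamPlaq hL hc hb, fun h => by
    obtain ⟨y', hy', h'⟩ := mem_biUnion.1 h
    exact plaq_not_mem_innerPlaq hL0 hΛ hc hb hy' h'⟩

/-! ## §5  Summation of (2.127)_κ₀ over the coarse bonds: `Step2127` and Lemma 2.4 with κ₀ -/

/-- The per-face inequalities (2.127)_κ₀ (`B6FaceLowerBound.face2127`) summed over the coarse bonds meeting Λ′
(the cell's reconstruction of the unprinted passage (2.127) + (2.123) ⟹ (2.128), census G-B6-08). [folklore] -/
theorem sum_face2127 (hd : 2 ≤ d) (hL : 1 ≤ L) (Λ' : Finset (Fin d → ℤ)) (B : Cfg d) :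
    kappa0 d L * ((L : ℝ)⁻¹) ^ (d + 1) * ∑ c ∈ coarseBonds L Λ', ∑ x ∈ lastLayer L c.1 c.2, B (x, c.2) ^ 2
      - 3 * ((L : ℝ)⁻¹) ^ d * (∑ c ∈ coarseBonds L Λ', ∑ b ∈ innerBonds L c.1, B b ^ 2
          + ∑ c ∈ coarseBonds L Λ', ∑ b ∈ innerBonds L (c.1 + (L : ℤ) • unitVec c.2), B b ^ 2) ≤
    3 * (((L : ℝ)⁻¹) ^ d * ∑ c ∈ coarseBonds L Λ', ∑ b ∈ bondsIn (lastLayer L c.1 c.2), curl B b.1 b.2 c.2 ^ 2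
      + q1Of L Λ' B) := by
  have h := sum_le_sum fun c (_ : c ∈ coarseBonds L Λ') => face2127 hd hL c.1 c.2 B
  have e1 : ∑ c ∈ coarseBonds L Λ',
      (kappa0 d L * ((L : ℝ)⁻¹) ^ (d + 1) * ∑ x ∈ lastLayer L c.1 c.2, B (x, c.2) ^ 2
        - 3 * ((L : ℝ)⁻¹) ^ d * (∑ b ∈ innerBonds L c.1, B b ^ 2
          + ∑ b ∈ innerBonds L (c.1 + (L : ℤ) • unitVec c.2), B b ^ 2)) =
      kappa0 d L * ((L : ℝ)⁻¹) ^ (d + 1) * ∑ c ∈ coarseBonds L Λ', ∑ x ∈ lastLayer L c.1 c.2, B (x, c.2) ^ 2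
      - 3 * ((L : ℝ)⁻¹) ^ d * (∑ c ∈ coarseBonds L Λ', ∑ b ∈ innerBonds L c.1, B b ^ 2
          + ∑ c ∈ coarseBonds L Λ', ∑ b ∈ innerBonds L (c.1 + (L : ℤ) • unitVec c.2), B b ^ 2) := by
    rw [sum_sub_distrib, ← mul_sum, ← mul_sum, sum_add_distrib]
  have e2 : ∑ c ∈ coarseBonds L Λ',
      3 * (((L : ℝ)⁻¹) ^ d * ∑ b ∈ bondsIn (lastLayer L c.1 c.2), curl B b.1 b.2 c.2 ^ 2
        + q1Term L B (c.1, c.2)) =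
      3 * (((L : ℝ)⁻¹) ^ d * ∑ c ∈ coarseBonds L Λ', ∑ b ∈ bondsIn (lastLayer L c.1 c.2),
        curl B b.1 b.2 c.2 ^ 2 + q1Of L Λ' B) := by
    rw [← mul_sum, sum_add_distrib, ← mul_sum]
    rfl
  linarith [h, e1, e2]

/-- **`B6.Step2127 d L κ₀` HOLDS for the concrete carrier** (d ≥ 2, L ≥ 1, Λ′ ⊂ LZ^d finite, Q₁-term (2.125)):
κ₀L^{−d−1}N_cr(B) − 6dL^{−d}N_in(B) ≤ 3(L^{−d}P_cr(B) + Σ_c|(Q₁B)(c)|²) for every B vanishing outside Λ (the tree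
gauge part of the hypothesis is not even used).  κ₀ = 1/(4 + 6d(L−1)L^{d−2}) replaces the printed, refuted factor 1.
[cite: Balaban1984PropagatorsII, (2.127)–(2.128) p.245] -/
theorem step2127 (hd : 2 ≤ d) (hL : 1 ≤ L) {Λ' : Finset (Fin d → ℤ)} (hΛ : ∀ y ∈ Λ', ∀ i, (L : ℤ) ∣ y i) :
    Step2127 d (L : ℝ) (kappa0 d L) (carrier L Λ' (q1Of L Λ'))
      (split (Nat.lt_of_lt_of_le Nat.zero_lt_one hL) hΛ (q1Of L Λ') (q1Of_nonneg Λ')) := by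
  intro B hB
  obtain ⟨hB0, -⟩ := hB
  have hL0 : 0 < L := Nat.lt_of_lt_of_le Nat.zero_lt_one hL
  show kappa0 d L * ((L : ℝ)⁻¹) ^ (d + 1) * (normSq L Λ' B - nIn L Λ' B)
      - 6 * (d : ℝ) * ((L : ℝ)⁻¹) ^ d * nIn L Λ' B ≤
    3 * (((L : ℝ)⁻¹) ^ d * (d1Sq L Λ' B - pIn L Λ' B) + q1Of L Λ' B)
  have hF := faces_le_pCr hL hΛ B
  have hC := crossing_cover hL0 hΛ B
  have hN1 := sum_blockSq_minus_le hL0 hΛ hB0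
  have hN2 := sum_blockSq_plus_le hL0 hΛ hB0
  have hsum := sum_face2127 hd hL Λ' B
  have hk : 0 ≤ kappa0 d L * ((L : ℝ)⁻¹) ^ (d + 1) := mul_nonneg (kappa0_pos hL).le (by positivity)
  have hℓ : 0 ≤ ((L : ℝ)⁻¹) ^ d := by positivity
  have h1 := mul_le_mul_of_nonneg_left hC hk
  have h2 := mul_le_mul_of_nonneg_left hF hℓ
  have h3 := mul_le_mul_of_nonneg_left (add_le_add hN1 hN2) hℓ
  linarith

/-- **Lemma 2.4 with the constant κ₀ for every family of concrete carriers** (d ≥ 2, L ≥ 1, Λ′_i ⊂ LZ^d,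
Q₁-term (2.125)): `B6.Lemma24K d L κ₀`, i.e. (κ₀/(12d²)) L^{−d−1}‖B‖² ≤ L^{d−2} Σ_c|(Q₁B)(c)|² + Σ_p|(∂₁B)(p)|²
for all B satisfying (2.121) — the whole chain (2.123)–(2.128) kernel-checked, with κ₀ in place of the printed
(refuted) layer factor 1. [cite: Balaban1984PropagatorsII, Lemma 2.4 (2.128) p.245] -/
theorem lemma24K {I : Type} (hd : 2 ≤ d) (hL : 1 ≤ L) (Λ' : I → Finset (Fin d → ℤ))
    (hΛ : ∀ i, ∀ y ∈ Λ' i, ∀ j, (L : ℤ) ∣ y j) :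
    Lemma24K d (L : ℝ) (kappa0 d L) (fun i => carrier L (Λ' i) (q1Of L (Λ' i))) :=
  lemma24K_of_step2127 hd hL (kappa0_le_one hL) Λ' hΛ (fun i => q1Of L (Λ' i)) (fun i => q1Of_nonneg (Λ' i))
    fun i => step2127 hd hL (hΛ i)

/-- The constant of the kernel-checked Lemma 2.4, unfolded: for one region, every B with B = 0 outside Λ and the
tree gauge (2.121) in every block satisfies (κ₀/(12d²)) L^{−(d+1)} ‖B‖² ≤ L^{d−2} Σ_c|(Q₁B)(c)|² + Σ_p|(∂₁B)(p)|².
[cite: Balaban1984PropagatorsII, Lemma 2.4 (2.128) p.245] -/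
theorem lemma24_kappa0 (hd : 2 ≤ d) (hL : 1 ≤ L) {Λ' : Finset (Fin d → ℤ)}
    (hΛ : ∀ y ∈ Λ', ∀ i, (L : ℤ) ∣ y i) (B : Cfg d) (hB0 : ∀ b, b ∉ lamBonds L Λ' → B b = 0)
    (hT : ∀ y ∈ Λ', ∀ b ∈ B6BondElimination.treeBonds L y, B b = 0) :
    kappa0 d L / (12 * (d : ℝ) ^ 2) * (L : ℝ) ^ (-((d : ℝ) + 1)) * normSq L Λ' B ≤
      (L : ℝ) ^ ((d : ℝ) - 2) * q1Of L Λ' B + d1Sq L Λ' B :=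
  lemma24K (I := Unit) hd hL (fun _ => Λ') (fun _ => hΛ) () B ⟨hB0, hT⟩

end

end Literature.MathematicalPhysics.QuantumFieldTheory.Balaban1983to89.B6Lemma24Assembly
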